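import Summits.Ventures.HodgeRepro2.A2HardLefschetzMain
import Summits.Ventures.HodgeRepro2.A2TwelvePlanes

/-!
# A2 annex — hard Lefschetz with the section's numbers: `|ι| = 12`, `L^8 : ⋀^4 → ⋀^{20}` bijective, and (A9)'s `y'' = (L^8)^{-1} z`

Cell pub-hodge-repro2, seat p6 (Tier-4 sub-claim A2). The twelve-plane instance of
`A2HardLefschetzMain` (ι = `Fin 12`, `2|ι| = 24 = 2 dim B`): for every `θ = Σ_p c_p E_p` with all
`c_p ≠ 0`,

* `hardLefschetz_twelve` — `θ^8 ∧ · : ⋀^4 → ⋀^{20}` is bijective (Voisin Theorem 6.25 at `n = 12`,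
  `k = 4`, the E40 datum of row 75's structure `HardLefschetz D θ`, now a theorem of the model);
* `lefschetz_surjOn_twelve` — `θ ∧ · : ⋀^d → ⋀^{d+2}` is onto for `11 ≤ d ≤ 22`;
* `yPP` — (A9)'s class `y'' = (L^8)^{-1}(z)` for `z ∈ ⋀^{20}`, with `θ^8 ∧ y'' = z`, `y'' ∈ ⋀^4` and
  its uniqueness (`theta_pow_eight_mul_yPP`, `yPP_mem`, `yPP_unique`).

Nothing about varieties is asserted (A0.3 (ii) identifies the model with `H^*(B, ℂ)`; row 7's
`z = f_*[S] ∈ H^{20}(B)` is the prose's class).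
-/

namespace Summit.Ventures.HodgeRepro2.A2HardLefschetzTwelve

open WeilPlanes WeilCoproduct A2HardLefschetzMain A2TwelvePlanes

/-- HARD LEFSCHETZ FOR TWELVE PLANES: `θ^8 ∧ ·` maps `⋀^4` bijectively onto `⋀^{20}`. -/
theorem hardLefschetz_twelve {c : ι₁₂ → ℂ} (hc : ∀ p, c p ≠ 0) :
    Set.BijOn (fun x => theta c ^ 8 * x) (grading ι₁₂ 4 : Set (A ι₁₂))
      (grading ι₁₂ 20 : Set (A ι₁₂)) := by
  have h := hardLefschetz_bijOn hc (k := 4) (by rw [card_twelve]; norm_num)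
  rw [card_twelve] at h
  norm_num at h
  exact h

/-- Above the middle, `θ ∧ · : ⋀^d → ⋀^{d+2}` is onto for `11 ≤ d ≤ 22` (twelve planes). -/
theorem lefschetz_surjOn_twelve {c : ι₁₂ → ℂ} (hc : ∀ p, c p ≠ 0) {d : ℕ} (hd : 11 ≤ d)
    (hd' : d ≤ 22) :
    Set.SurjOn (fun x => theta c * x) (grading ι₁₂ d : Set (A ι₁₂))
      (grading ι₁₂ (d + 2) : Set (A ι₁₂)) :=
  lef_surjOn_of_le hc (by rw [card_twelve]; omega) (by rw [card_twelve]; omega)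

/-- (A9)'s class `y'' = (L^8)^{-1}(z)` for `z ∈ ⋀^{20}`: the unique `y ∈ ⋀^4` with `θ^8 ∧ y = z`. -/
noncomputable def yPP (c : ι₁₂ → ℂ) (hc : ∀ p, c p ≠ 0) {z : A ι₁₂} (hz : z ∈ grading ι₁₂ 20) :
    A ι₁₂ :=
  Classical.choose ((hardLefschetz_twelve hc).surjOn hz)

/-- `y'' ∈ ⋀^4`. -/
theorem yPP_mem (c : ι₁₂ → ℂ) (hc : ∀ p, c p ≠ 0) {z : A ι₁₂} (hz : z ∈ grading ι₁₂ 20) :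
    yPP c hc hz ∈ grading ι₁₂ 4 :=
  (Classical.choose_spec ((hardLefschetz_twelve hc).surjOn hz)).1

/-- `θ^8 ∧ y'' = z`. -/
theorem theta_pow_eight_mul_yPP (c : ι₁₂ → ℂ) (hc : ∀ p, c p ≠ 0) {z : A ι₁₂}
    (hz : z ∈ grading ι₁₂ 20) : theta c ^ 8 * yPP c hc hz = z :=
  (Classical.choose_spec ((hardLefschetz_twelve hc).surjOn hz)).2

/-- Uniqueness of `y''` in `⋀^4`. -/
theorem yPP_unique (c : ι₁₂ → ℂ) (hc : ∀ p, c p ≠ 0) {z : A ι₁₂} (hz : z ∈ grading ι₁₂ 20)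
    {y : A ι₁₂} (hy : y ∈ grading ι₁₂ 4) (hyz : theta c ^ 8 * y = z) : y = yPP c hc hz :=
  (hardLefschetz_twelve hc).injOn hy (yPP_mem c hc hz)
    (by rw [hyz, theta_pow_eight_mul_yPP])

end Summit.Ventures.HodgeRepro2.A2HardLefschetzTwelve
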